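import Literature.Analysis.FluidPDE.CompressibleEulerCoefficients
import Literature.Analysis.FluidPDE.CompressibleEulerResidualBounds
import HarnessLib

/-!
# The space-differentiated compressible Euler system: residual identification up to order three

Analysis/FluidPDE support file (everything proved; no named facts), part of the programme
proving `Literature.Analysis.FluidPDE.CompressibleEulerLocalWellPosedness` (Majda 1984,
Thms 2.1–2.2). For a smooth solution `(ρ, u, ϑ)` of the Euler system of the athermal monatomic
law in primitive/symmetric form on a slab `[0, τ] × 𝕋³`
(`IsPrimitiveEulerSolutionOn`, coefficients `coefA/B/G` of `CompressibleEulerCoefficients`), the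
space derivatives `(∂ⱼρ, ∂ⱼu, ∂ⱼϑ)`, `(∂ₖ∂ⱼρ, …)`, `(∂ₗ∂ₖ∂ⱼρ, …)` satisfy the LINEARISED system

  `∂ₜr + ∑ᵢ uᵢ∂ᵢr + ρ div w = R₁`, `∂ₜw + ∑ᵢ uᵢ∂ᵢw + a∇r + b∇θ = R₂`, `∂ₜθ + ∑ᵢ uᵢ∂ᵢθ + g div w = R₃`

with residuals that are explicit commutator expressions in the zeroth-order terms `T₁ = tcont`,
`T₂ = tmom` of `CompressibleEulerResidualBounds` and their derivatives (Majda 1984, Ch. 2 §2.1,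
proof of Thm 2.1: "`∂^α` of the system = the system for `∂^αU` + commutators"):

* level 1: `R = -T(U)ⱼ`;
* level 2: `R = -∂ₖ[T(U)ⱼ] - T(∂ⱼU)ₖ`;
* level 3: `R = -∂ₗ∂ₖ[T(U)ⱼ] - ∂ₗ[T(∂ⱼU)ₖ] - T(∂ₖ∂ⱼU)ₗ`

(`res₁_level₁/₂/₃`, `res₂_level₁/₂/₃`, `res₃_level₁/₂/₃`), by iterating
`CompressibleEulerLinearizedDerivative.partialDeriv_res₁/₂/₃` starting from the equations.

## References

* A. Majda, *Compressible Fluid Flow and Systems of Conservation Laws in Several Space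
  Variables*, Springer 1984, Ch. 2 §2.1, proof of Thm 2.1, Thm 2.2. [`Majda1984`]
-/

noncomputable section

open Set Function
open scoped ContDiff

namespace Literature.Analysis.FluidPDE

namespace CompressibleEuler

open Literature.Analysis.FunctionSpaces FunctionSpaces.Torus

variable {ζ f : ℝ → ℝ} {τ : ℝ} {ρ ϑ : ℝ → UnitAddTorus (Fin 3) → ℝ}
  {u : ℝ → UnitAddTorus (Fin 3) → EuclideanSpace ℝ (Fin 3)}

/-! ## One differentiation step -/

section Step

variable {d : Type*} [Fintype d] [DecidableEq d] {t₀ t₁ : ℝ} {r θ a b c g : ℝ → UnitAddTorus d → ℝ}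
  {w v : ℝ → UnitAddTorus d → EuclideanSpace ℝ d}

/-- Negation commutes with partial derivatives (pointwise form). [folklore] -/
theorem partialDeriv_fun_neg {F : Type*} [NormedAddCommGroup F] [NormedSpace ℝ F] {φ : UnitAddTorus d → F}
    (hφ : IsSmooth φ) (i : d) (x : UnitAddTorus d) :
    partialDeriv i (fun y => -φ y) x = -partialDeriv i φ x := by
  have e : (fun y => -φ y) = (-1 : ℝ) • φ := by funext y; simp
  rw [e, partialDeriv_const_smul (hφ.isContDiff (by simp)) (-1) i]
  simp

/-- Subtraction commutes with partial derivatives (pointwise form). [folklore] -/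
theorem partialDeriv_fun_sub {F : Type*} [NormedAddCommGroup F] [NormedSpace ℝ F] {φ ψ : UnitAddTorus d → F}
    (hφ : IsSmooth φ) (hψ : IsSmooth ψ) (i : d) (x : UnitAddTorus d) :
    partialDeriv i (fun y => φ y - ψ y) x = partialDeriv i φ x - partialDeriv i ψ x := by
  have e : (fun y => φ y - ψ y) = φ + fun y => -ψ y := by funext y; simp [sub_eq_add_neg]
  have hn : IsSmooth (fun y => -ψ y) := hψ.neg
  rw [e, partialDeriv_add (hφ.isContDiff (by simp)) (hn.isContDiff (by simp)), Pi.add_apply,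
    partialDeriv_fun_neg hψ, sub_eq_add_neg]

/-- **Continuity-type step**: if `(r, w)` has level residual function `Φ` at time `t`, then
`(∂ⱼr, ∂ⱼw)` has residual `∂ⱼΦ - T₁(r, w)ⱼ`. [cite: Majda1984, Ch. 2 §2.1, proof of Thm 2.1] -/
theorem res₁_step (ht : t₀ < t₁) (hr : IsSmoothSpaceTimeOn (Icc t₀ t₁) r) (hw : IsSmoothSpaceTimeOn (Icc t₀ t₁) w)
    (hv : IsSmoothSpaceTimeOn (Icc t₀ t₁) v) (hc : IsSmoothSpaceTimeOn (Icc t₀ t₁) c) {t : ℝ} (hts : t ∈ Icc t₀ t₁)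
    (j : d) (x : UnitAddTorus d) {Φ : UnitAddTorus d → ℝ}
    (hΦ : (fun y => timeDerivWithin (Icc t₀ t₁) r t y + (∑ i, v t y i * partialDeriv i (r t) y) +
      c t y * divergence (w t) y) = Φ) :
    timeDerivWithin (Icc t₀ t₁) (fun s => partialDeriv j (r s)) t x +
        (∑ i, v t x i * partialDeriv i (partialDeriv j (r t)) x) + c t x * divergence (partialDeriv j (w t)) x =
      partialDeriv j Φ x - tcont (v t) (c t) (r t) (w t) j x := by
  have h := partialDeriv_res₁ ht hr hw hv hc hts j x
  rw [hΦ] at h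
  simp only [tcont]
  linarith

/-- **Momentum-type step**. [cite: Majda1984, Ch. 2 §2.1, proof of Thm 2.1] -/
theorem res₂_step (ht : t₀ < t₁) (hr : IsSmoothSpaceTimeOn (Icc t₀ t₁) r) (hθ : IsSmoothSpaceTimeOn (Icc t₀ t₁) θ)
    (hw : IsSmoothSpaceTimeOn (Icc t₀ t₁) w) (hv : IsSmoothSpaceTimeOn (Icc t₀ t₁) v)
    (ha : IsSmoothSpaceTimeOn (Icc t₀ t₁) a) (hb : IsSmoothSpaceTimeOn (Icc t₀ t₁) b) {t : ℝ} (hts : t ∈ Icc t₀ t₁)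
    (j : d) (x : UnitAddTorus d) {Φ : UnitAddTorus d → EuclideanSpace ℝ d}
    (hΦ : (fun y => timeDerivWithin (Icc t₀ t₁) w t y + (∑ i, v t y i • partialDeriv i (w t) y) +
      a t y • gradient (r t) y + b t y • gradient (θ t) y) = Φ) :
    timeDerivWithin (Icc t₀ t₁) (fun s => partialDeriv j (w s)) t x +
        (∑ i, v t x i • partialDeriv i (partialDeriv j (w t)) x) +
        a t x • gradient (partialDeriv j (r t)) x + b t x • gradient (partialDeriv j (θ t)) x =
      partialDeriv j Φ x - tmom (v t) (a t) (b t) (r t) (θ t) (w t) j x := by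
  have h := partialDeriv_res₂ ht hr hθ hw hv ha hb hts j x
  rw [hΦ] at h
  simp only [tmom]
  rw [h]
  abel

end Step

/-! ## Levels one to three along a solution -/

section Levels

variable (hζ : ContDiff ℝ ∞ ζ) (hτ : 0 < τ)
  (h : IsPrimitiveEulerSolutionOn (EulerEOS.monatomicExcess ζ f) (Icc 0 τ) ρ u ϑ)

include h hτ in
/-- **Continuity equation, level 1**: `(∂ⱼρ, ∂ⱼu)` has residual `-T₁(ρ, u)ⱼ`.
[cite: Majda1984, Ch. 2 §2.1, proof of Thm 2.1] -/
theorem res₁_level₁ {s : ℝ} (hs : s ∈ Icc 0 τ) (j : Fin 3) (x : UnitAddTorus (Fin 3)) :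
    timeDerivWithin (Icc 0 τ) (fun t => partialDeriv j (ρ t)) s x +
        (∑ i, u s x i * partialDeriv i (partialDeriv j (ρ s)) x) + ρ s x * divergence (partialDeriv j (u s)) x =
      -tcont (u s) (ρ s) (ρ s) (u s) j x := by
  have hz := res₁_step hτ h.smooth_density h.smooth_velocity h.smooth_velocity h.smooth_density hs j x
    (res₁_fun_eq_zero h hs)
  rw [hz]
  simp [partialDeriv, Torus.lineDeriv]

include h hτ in
/-- **Continuity equation, level 2**. [cite: Majda1984, Ch. 2 §2.1, proof of Thm 2.1] -/
theorem res₁_level₂ {s : ℝ} (hs : s ∈ Icc 0 τ) (j k : Fin 3) (x : UnitAddTorus (Fin 3)) :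
    timeDerivWithin (Icc 0 τ) (fun t => partialDeriv k (partialDeriv j (ρ t))) s x +
        (∑ i, u s x i * partialDeriv i (partialDeriv k (partialDeriv j (ρ s))) x) +
        ρ s x * divergence (partialDeriv k (partialDeriv j (u s))) x =
      -(partialDeriv k (tcont (u s) (ρ s) (ρ s) (u s) j) x) -
        tcont (u s) (ρ s) (partialDeriv j (ρ s)) (partialDeriv j (u s)) k x := by
  have hU : UniqueDiffOn ℝ (Icc 0 τ) := uniqueDiffOn_Icc hτ
  have hΦ : (fun y => timeDerivWithin (Icc 0 τ) (fun t => partialDeriv j (ρ t)) s y +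
      (∑ i, u s y i * partialDeriv i (partialDeriv j (ρ s)) y) + ρ s y * divergence (partialDeriv j (u s)) y) =
      fun y => -tcont (u s) (ρ s) (ρ s) (u s) j y := funext fun y => res₁_level₁ hτ h hs j y
  have hz := res₁_step (r := fun t => partialDeriv j (ρ t)) (w := fun t => partialDeriv j (u t)) hτ
    (h.smooth_density.partialDeriv hU j) (h.smooth_velocity.partialDeriv hU j) h.smooth_velocity h.smooth_density
    hs k x hΦ
  rw [hz]
  have hT : IsSmooth (tcont (u s) (ρ s) (ρ s) (u s) j) :=
    isSmooth_tcont (h.smooth_velocity.isSmooth_slice hs) (h.smooth_density.isSmooth_slice hs)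
      (h.smooth_density.isSmooth_slice hs) (h.smooth_velocity.isSmooth_slice hs) j
  rw [partialDeriv_fun_neg hT]

include h hτ in
/-- **Continuity equation, level 3**. [cite: Majda1984, Ch. 2 §2.1, proof of Thm 2.1] -/
theorem res₁_level₃ {s : ℝ} (hs : s ∈ Icc 0 τ) (j k l : Fin 3) (x : UnitAddTorus (Fin 3)) :
    timeDerivWithin (Icc 0 τ) (fun t => partialDeriv l (partialDeriv k (partialDeriv j (ρ t)))) s x +
        (∑ i, u s x i * partialDeriv i (partialDeriv l (partialDeriv k (partialDeriv j (ρ s)))) x) +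
        ρ s x * divergence (partialDeriv l (partialDeriv k (partialDeriv j (u s)))) x =
      -(partialDeriv l (partialDeriv k (tcont (u s) (ρ s) (ρ s) (u s) j)) x) -
        partialDeriv l (tcont (u s) (ρ s) (partialDeriv j (ρ s)) (partialDeriv j (u s)) k) x -
        tcont (u s) (ρ s) (partialDeriv k (partialDeriv j (ρ s))) (partialDeriv k (partialDeriv j (u s))) l x := by
  have hU : UniqueDiffOn ℝ (Icc 0 τ) := uniqueDiffOn_Icc hτ
  have hus := h.smooth_velocity.isSmooth_slice hs
  have hρs := h.smooth_density.isSmooth_slice hs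
  have hT₁ : IsSmooth (tcont (u s) (ρ s) (ρ s) (u s) j) := isSmooth_tcont hus hρs hρs hus j
  have hT₂ : IsSmooth (tcont (u s) (ρ s) (partialDeriv j (ρ s)) (partialDeriv j (u s)) k) :=
    isSmooth_tcont hus hρs (hρs.partialDeriv j) (hus.partialDeriv j) k
  have hΦ : (fun y => timeDerivWithin (Icc 0 τ) (fun t => partialDeriv k (partialDeriv j (ρ t))) s y +
      (∑ i, u s y i * partialDeriv i (partialDeriv k (partialDeriv j (ρ s))) y) +
      ρ s y * divergence (partialDeriv k (partialDeriv j (u s))) y) =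
      fun y => -(partialDeriv k (tcont (u s) (ρ s) (ρ s) (u s) j) y) -
        tcont (u s) (ρ s) (partialDeriv j (ρ s)) (partialDeriv j (u s)) k y :=
    funext fun y => res₁_level₂ hτ h hs j k y
  have hz := res₁_step (r := fun t => partialDeriv k (partialDeriv j (ρ t)))
    (w := fun t => partialDeriv k (partialDeriv j (u t))) hτ
    ((h.smooth_density.partialDeriv hU j).partialDeriv hU k) ((h.smooth_velocity.partialDeriv hU j).partialDeriv hU k)
    h.smooth_velocity h.smooth_density hs l x hΦ
  have hn : IsSmooth (fun y => -partialDeriv k (tcont (u s) (ρ s) (ρ s) (u s) j) y) := (hT₁.partialDeriv k).neg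
  rw [hz, partialDeriv_fun_sub hn hT₂ l x, partialDeriv_fun_neg (hT₁.partialDeriv k) l x]

include hζ h hτ in
/-- **Momentum equation, level 1**. [cite: Majda1984, Ch. 2 §2.1, proof of Thm 2.1] -/
theorem res₂_level₁ {s : ℝ} (hs : s ∈ Icc 0 τ) (j : Fin 3) (x : UnitAddTorus (Fin 3)) :
    timeDerivWithin (Icc 0 τ) (fun t => partialDeriv j (u t)) s x +
        (∑ i, u s x i • partialDeriv i (partialDeriv j (u s)) x) +
        coefA ζ ρ ϑ s x • gradient (partialDeriv j (ρ s)) x + coefB ζ ρ s x • gradient (partialDeriv j (ϑ s)) x =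
      -tmom (u s) (coefA ζ ρ ϑ s) (coefB ζ ρ s) (ρ s) (ϑ s) (u s) j x := by
  have hz := res₂_step hτ h.smooth_density h.smooth_temperature h.smooth_velocity h.smooth_velocity
    (isSmoothSpaceTimeOn_coefA hζ h) (isSmoothSpaceTimeOn_coefB hζ h) hs j x (res₂_fun_eq_zero hζ h hs)
  rw [hz]
  simp [partialDeriv, Torus.lineDeriv]

include hζ h hτ in
/-- **Momentum equation, level 2**. [cite: Majda1984, Ch. 2 §2.1, proof of Thm 2.1] -/
theorem res₂_level₂ {s : ℝ} (hs : s ∈ Icc 0 τ) (j k : Fin 3) (x : UnitAddTorus (Fin 3)) :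
    timeDerivWithin (Icc 0 τ) (fun t => partialDeriv k (partialDeriv j (u t))) s x +
        (∑ i, u s x i • partialDeriv i (partialDeriv k (partialDeriv j (u s))) x) +
        coefA ζ ρ ϑ s x • gradient (partialDeriv k (partialDeriv j (ρ s))) x +
        coefB ζ ρ s x • gradient (partialDeriv k (partialDeriv j (ϑ s))) x =
      -(partialDeriv k (tmom (u s) (coefA ζ ρ ϑ s) (coefB ζ ρ s) (ρ s) (ϑ s) (u s) j) x) -
        tmom (u s) (coefA ζ ρ ϑ s) (coefB ζ ρ s) (partialDeriv j (ρ s)) (partialDeriv j (ϑ s))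
          (partialDeriv j (u s)) k x := by
  have hU : UniqueDiffOn ℝ (Icc 0 τ) := uniqueDiffOn_Icc hτ
  have hA := isSmoothSpaceTimeOn_coefA hζ h
  have hB := isSmoothSpaceTimeOn_coefB hζ h
  have hΦ : (fun y => timeDerivWithin (Icc 0 τ) (fun t => partialDeriv j (u t)) s y +
      (∑ i, u s y i • partialDeriv i (partialDeriv j (u s)) y) +
      coefA ζ ρ ϑ s y • gradient (partialDeriv j (ρ s)) y + coefB ζ ρ s y • gradient (partialDeriv j (ϑ s)) y) =
      fun y => -tmom (u s) (coefA ζ ρ ϑ s) (coefB ζ ρ s) (ρ s) (ϑ s) (u s) j y :=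
    funext fun y => res₂_level₁ hζ hτ h hs j y
  have hz := res₂_step (r := fun t => partialDeriv j (ρ t)) (θ := fun t => partialDeriv j (ϑ t))
    (w := fun t => partialDeriv j (u t)) hτ (h.smooth_density.partialDeriv hU j)
    (h.smooth_temperature.partialDeriv hU j) (h.smooth_velocity.partialDeriv hU j) h.smooth_velocity hA hB hs k x hΦ
  rw [hz]
  have hT : IsSmooth (tmom (u s) (coefA ζ ρ ϑ s) (coefB ζ ρ s) (ρ s) (ϑ s) (u s) j) :=
    isSmooth_tmom (h.smooth_velocity.isSmooth_slice hs) (hA.isSmooth_slice hs) (hB.isSmooth_slice hs)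
      (h.smooth_density.isSmooth_slice hs) (h.smooth_temperature.isSmooth_slice hs)
      (h.smooth_velocity.isSmooth_slice hs) j
  rw [partialDeriv_fun_neg hT]

include hζ h hτ in
/-- **Momentum equation, level 3**. [cite: Majda1984, Ch. 2 §2.1, proof of Thm 2.1] -/
theorem res₂_level₃ {s : ℝ} (hs : s ∈ Icc 0 τ) (j k l : Fin 3) (x : UnitAddTorus (Fin 3)) :
    timeDerivWithin (Icc 0 τ) (fun t => partialDeriv l (partialDeriv k (partialDeriv j (u t)))) s x +
        (∑ i, u s x i • partialDeriv i (partialDeriv l (partialDeriv k (partialDeriv j (u s)))) x) +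
        coefA ζ ρ ϑ s x • gradient (partialDeriv l (partialDeriv k (partialDeriv j (ρ s)))) x +
        coefB ζ ρ s x • gradient (partialDeriv l (partialDeriv k (partialDeriv j (ϑ s)))) x =
      -(partialDeriv l (partialDeriv k (tmom (u s) (coefA ζ ρ ϑ s) (coefB ζ ρ s) (ρ s) (ϑ s) (u s) j)) x) -
        partialDeriv l (tmom (u s) (coefA ζ ρ ϑ s) (coefB ζ ρ s) (partialDeriv j (ρ s)) (partialDeriv j (ϑ s))
          (partialDeriv j (u s)) k) x -
        tmom (u s) (coefA ζ ρ ϑ s) (coefB ζ ρ s) (partialDeriv k (partialDeriv j (ρ s)))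
          (partialDeriv k (partialDeriv j (ϑ s))) (partialDeriv k (partialDeriv j (u s))) l x := by
  have hU : UniqueDiffOn ℝ (Icc 0 τ) := uniqueDiffOn_Icc hτ
  have hA := isSmoothSpaceTimeOn_coefA hζ h
  have hB := isSmoothSpaceTimeOn_coefB hζ h
  have hus := h.smooth_velocity.isSmooth_slice hs
  have hρs := h.smooth_density.isSmooth_slice hs
  have hϑs := h.smooth_temperature.isSmooth_slice hs
  have hAs := hA.isSmooth_slice hs
  have hBs := hB.isSmooth_slice hs
  have hT₁ : IsSmooth (tmom (u s) (coefA ζ ρ ϑ s) (coefB ζ ρ s) (ρ s) (ϑ s) (u s) j) :=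
    isSmooth_tmom hus hAs hBs hρs hϑs hus j
  have hT₂ : IsSmooth (tmom (u s) (coefA ζ ρ ϑ s) (coefB ζ ρ s) (partialDeriv j (ρ s)) (partialDeriv j (ϑ s))
      (partialDeriv j (u s)) k) :=
    isSmooth_tmom hus hAs hBs (hρs.partialDeriv j) (hϑs.partialDeriv j) (hus.partialDeriv j) k
  have hΦ : (fun y => timeDerivWithin (Icc 0 τ) (fun t => partialDeriv k (partialDeriv j (u t))) s y +
      (∑ i, u s y i • partialDeriv i (partialDeriv k (partialDeriv j (u s))) y) +
      coefA ζ ρ ϑ s y • gradient (partialDeriv k (partialDeriv j (ρ s))) y +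
      coefB ζ ρ s y • gradient (partialDeriv k (partialDeriv j (ϑ s))) y) =
      fun y => -(partialDeriv k (tmom (u s) (coefA ζ ρ ϑ s) (coefB ζ ρ s) (ρ s) (ϑ s) (u s) j) y) -
        tmom (u s) (coefA ζ ρ ϑ s) (coefB ζ ρ s) (partialDeriv j (ρ s)) (partialDeriv j (ϑ s))
          (partialDeriv j (u s)) k y :=
    funext fun y => res₂_level₂ hζ hτ h hs j k y
  have hz := res₂_step (r := fun t => partialDeriv k (partialDeriv j (ρ t)))
    (θ := fun t => partialDeriv k (partialDeriv j (ϑ t))) (w := fun t => partialDeriv k (partialDeriv j (u t))) hτ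
    ((h.smooth_density.partialDeriv hU j).partialDeriv hU k) ((h.smooth_temperature.partialDeriv hU j).partialDeriv hU k)
    ((h.smooth_velocity.partialDeriv hU j).partialDeriv hU k) h.smooth_velocity hA hB hs l x hΦ
  have hn : IsSmooth (fun y => -partialDeriv k (tmom (u s) (coefA ζ ρ ϑ s) (coefB ζ ρ s) (ρ s) (ϑ s) (u s) j) y) := (hT₁.partialDeriv k).neg
  rw [hz, partialDeriv_fun_sub hn hT₂ l x, partialDeriv_fun_neg (hT₁.partialDeriv k) l x]

include hζ h hτ in
/-- **Temperature equation, level 1**. [cite: Majda1984, Ch. 2 §2.1, proof of Thm 2.1] -/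
theorem res₃_level₁ {s : ℝ} (hs : s ∈ Icc 0 τ) (j : Fin 3) (x : UnitAddTorus (Fin 3)) :
    timeDerivWithin (Icc 0 τ) (fun t => partialDeriv j (ϑ t)) s x +
        (∑ i, u s x i * partialDeriv i (partialDeriv j (ϑ s)) x) +
        coefG ζ ρ ϑ s x * divergence (partialDeriv j (u s)) x =
      -tcont (u s) (coefG ζ ρ ϑ s) (ϑ s) (u s) j x := by
  have hz := res₁_step hτ h.smooth_temperature h.smooth_velocity h.smooth_velocity (isSmoothSpaceTimeOn_coefG hζ h)
    hs j x (res₃_fun_eq_zero hτ h hs)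
  rw [hz]
  simp [partialDeriv, Torus.lineDeriv]

include hζ h hτ in
/-- **Temperature equation, level 2**. [cite: Majda1984, Ch. 2 §2.1, proof of Thm 2.1] -/
theorem res₃_level₂ {s : ℝ} (hs : s ∈ Icc 0 τ) (j k : Fin 3) (x : UnitAddTorus (Fin 3)) :
    timeDerivWithin (Icc 0 τ) (fun t => partialDeriv k (partialDeriv j (ϑ t))) s x +
        (∑ i, u s x i * partialDeriv i (partialDeriv k (partialDeriv j (ϑ s))) x) +
        coefG ζ ρ ϑ s x * divergence (partialDeriv k (partialDeriv j (u s))) x =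
      -(partialDeriv k (tcont (u s) (coefG ζ ρ ϑ s) (ϑ s) (u s) j) x) -
        tcont (u s) (coefG ζ ρ ϑ s) (partialDeriv j (ϑ s)) (partialDeriv j (u s)) k x := by
  have hU : UniqueDiffOn ℝ (Icc 0 τ) := uniqueDiffOn_Icc hτ
  have hG := isSmoothSpaceTimeOn_coefG hζ h
  have hΦ : (fun y => timeDerivWithin (Icc 0 τ) (fun t => partialDeriv j (ϑ t)) s y +
      (∑ i, u s y i * partialDeriv i (partialDeriv j (ϑ s)) y) +
      coefG ζ ρ ϑ s y * divergence (partialDeriv j (u s)) y) =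
      fun y => -tcont (u s) (coefG ζ ρ ϑ s) (ϑ s) (u s) j y := funext fun y => res₃_level₁ hζ hτ h hs j y
  have hz := res₁_step (r := fun t => partialDeriv j (ϑ t)) (w := fun t => partialDeriv j (u t)) hτ
    (h.smooth_temperature.partialDeriv hU j) (h.smooth_velocity.partialDeriv hU j) h.smooth_velocity hG hs k x hΦ
  rw [hz]
  have hT : IsSmooth (tcont (u s) (coefG ζ ρ ϑ s) (ϑ s) (u s) j) :=
    isSmooth_tcont (h.smooth_velocity.isSmooth_slice hs) (hG.isSmooth_slice hs)
      (h.smooth_temperature.isSmooth_slice hs) (h.smooth_velocity.isSmooth_slice hs) j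
  rw [partialDeriv_fun_neg hT]

include hζ h hτ in
/-- **Temperature equation, level 3**. [cite: Majda1984, Ch. 2 §2.1, proof of Thm 2.1] -/
theorem res₃_level₃ {s : ℝ} (hs : s ∈ Icc 0 τ) (j k l : Fin 3) (x : UnitAddTorus (Fin 3)) :
    timeDerivWithin (Icc 0 τ) (fun t => partialDeriv l (partialDeriv k (partialDeriv j (ϑ t)))) s x +
        (∑ i, u s x i * partialDeriv i (partialDeriv l (partialDeriv k (partialDeriv j (ϑ s)))) x) +
        coefG ζ ρ ϑ s x * divergence (partialDeriv l (partialDeriv k (partialDeriv j (u s)))) x =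
      -(partialDeriv l (partialDeriv k (tcont (u s) (coefG ζ ρ ϑ s) (ϑ s) (u s) j)) x) -
        partialDeriv l (tcont (u s) (coefG ζ ρ ϑ s) (partialDeriv j (ϑ s)) (partialDeriv j (u s)) k) x -
        tcont (u s) (coefG ζ ρ ϑ s) (partialDeriv k (partialDeriv j (ϑ s))) (partialDeriv k (partialDeriv j (u s))) l x := by
  have hU : UniqueDiffOn ℝ (Icc 0 τ) := uniqueDiffOn_Icc hτ
  have hG := isSmoothSpaceTimeOn_coefG hζ h
  have hus := h.smooth_velocity.isSmooth_slice hs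
  have hϑs := h.smooth_temperature.isSmooth_slice hs
  have hGs := hG.isSmooth_slice hs
  have hT₁ : IsSmooth (tcont (u s) (coefG ζ ρ ϑ s) (ϑ s) (u s) j) := isSmooth_tcont hus hGs hϑs hus j
  have hT₂ : IsSmooth (tcont (u s) (coefG ζ ρ ϑ s) (partialDeriv j (ϑ s)) (partialDeriv j (u s)) k) :=
    isSmooth_tcont hus hGs (hϑs.partialDeriv j) (hus.partialDeriv j) k
  have hΦ : (fun y => timeDerivWithin (Icc 0 τ) (fun t => partialDeriv k (partialDeriv j (ϑ t))) s y +
      (∑ i, u s y i * partialDeriv i (partialDeriv k (partialDeriv j (ϑ s))) y) +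
      coefG ζ ρ ϑ s y * divergence (partialDeriv k (partialDeriv j (u s))) y) =
      fun y => -(partialDeriv k (tcont (u s) (coefG ζ ρ ϑ s) (ϑ s) (u s) j) y) -
        tcont (u s) (coefG ζ ρ ϑ s) (partialDeriv j (ϑ s)) (partialDeriv j (u s)) k y :=
    funext fun y => res₃_level₂ hζ hτ h hs j k y
  have hz := res₁_step (r := fun t => partialDeriv k (partialDeriv j (ϑ t)))
    (w := fun t => partialDeriv k (partialDeriv j (u t))) hτ
    ((h.smooth_temperature.partialDeriv hU j).partialDeriv hU k) ((h.smooth_velocity.partialDeriv hU j).partialDeriv hU k)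
    h.smooth_velocity hG hs l x hΦ
  have hn : IsSmooth (fun y => -partialDeriv k (tcont (u s) (coefG ζ ρ ϑ s) (ϑ s) (u s) j) y) := (hT₁.partialDeriv k).neg
  rw [hz, partialDeriv_fun_sub hn hT₂ l x, partialDeriv_fun_neg (hT₁.partialDeriv k) l x]

end Levels

end CompressibleEuler

end Literature.Analysis.FluidPDE

end
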